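import Mathlib
import HarnessLib
import Literature.Computability.AlgebraicComplexity.PatternExpressions
import Summits.ValiantsHypothesis.ValiantsHypothesis.Theorems.MonotoneRestorationOrbitCompressionQPShortClose

/-!
# Route MonotoneRestoration — aside `OrbitCompressionQP` (stmt-ValiantsHypothesis-18332), line
# `expression_compression`: BALANCED expressions for iterated products of expression matrices

Labelled pattern expressions are FORMULAS (trees): there is no sharing, and the length of a product of `N`
matrices of expressions computed naively left-to-right is exponential in `N`.  The standard balancing
(the argument behind «algebraic branching programs have quasi-polynomial formulas») applies verbatim inside the
bipartite graph algebra, because `value` is a ring homomorphism-like map on `add`/`mul` at EVERY label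
assignment:

* `value_foldr_add` — big sums evaluate termwise;
* `exists_matrixProd` — for a list of `≤ 2^s` square matrices of dimension `D` whose entries are expressions of
  length `≤ lam` (all with the same `k` row and `l` column labels) there is a matrix `P` of expressions with
  entries of length `≤ (2D+2)^s · (lam + D + 1)` whose entrywise value, at every level `n` and every label
  assignment, is the PRODUCT of the entrywise values (divide and conquer on the list; the empty product is the
  identity matrix of constants).

With `D, lam ≤ 2^{polylog}` and `s ≤ polylog` the bound is quasi-polynomial: this is the glue by which anything
computed from closed narrow expressions (e.g. the power sums of `Theorems/…NarrowClosureSums.lean`) by a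
quasi-polynomial-width, quasi-polynomial-length iterated matrix product — Newton's recurrence for the elementary
symmetric polynomials of the row sums, the «one-row stratum» of `stub_narrowExpressionCompression` — is again
narrow of quasi-polynomial length.  Helper file (`--supports stmt-ValiantsHypothesis-18332`); def-free; nothing
here is a named fact; VP ≠ VNP is not moved.
-/

noncomputable section

open MvPolynomial

-- `Summit.ValiantsHypothesis.ValiantsHypothesis.…` is the tree's single-conjunct layout (Sub = Summit).
set_option linter.dupNamespace false

namespace Summit.ValiantsHypothesis.ValiantsHypothesis.Theorems

namespace NarrowClosure

open Literature.Computability.AlgebraicComplexity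

variable {F : Type} [CommSemiring F] {k l : ℕ}

/-- **Big sums evaluate termwise** at every label assignment. [folklore] -/
theorem value_foldr_add (n : ℕ) (es : List (PatternExpr F k l)) (ρ : Fin k → Fin n) (γ : Fin l → Fin n) :
    (es.foldr PatternExpr.add (PatternExpr.const 0)).value n ρ γ = (es.map fun e => e.value n ρ γ).sum := by
  induction es with
  | nil => simp
  | cons e es ih => rw [List.foldr_cons, PatternExpr.value_add, ih, List.map_cons, List.sum_cons]

/-- **Balanced expressions for iterated matrix products.**  For a list of at most `2^s` matrices of dimension
`D` whose entries are expressions of length `≤ lam`, there is a matrix of expressions with entries of length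
`≤ (2D+2)^s (lam + D + 1)` whose entrywise value at every level and label assignment is the product of the
entrywise values of the list. [folklore] -/
theorem exists_matrixProd {D : ℕ} (lam : ℕ) :
    ∀ (s : ℕ) (L : List (Matrix (Fin D) (Fin D) (PatternExpr F k l))),
      L.length ≤ 2 ^ s → (∀ M ∈ L, ∀ i j, (M i j).length ≤ lam) →
      ∃ P : Matrix (Fin D) (Fin D) (PatternExpr F k l),
        (∀ i j, (P i j).length ≤ (2 * D + 2) ^ s * (lam + D + 1)) ∧
        ∀ (n : ℕ) (ρ : Fin k → Fin n) (γ : Fin l → Fin n),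
          (P.map fun e => e.value n ρ γ) = (L.map fun M => M.map fun e => e.value n ρ γ).prod := by
  classical
  intro s
  induction s with
  | zero =>
    intro L hL hlam
    match L, hL, hlam with
    | [], _, _ =>
      refine ⟨Matrix.of fun i j => if i = j then PatternExpr.const 1 else PatternExpr.const 0, ?_, ?_⟩
      · intro i j
        simp only [Matrix.of_apply]
        split_ifs <;> simp [PatternExpr.length]
      · intro n ρ γ
        ext i j
        simp only [Matrix.map_apply, Matrix.of_apply, List.map_nil, List.prod_nil, Matrix.one_apply]
        split_ifs <;> simp
    | [M], _, hlam =>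
      refine ⟨M, fun i j => ?_, fun n ρ γ => by simp⟩
      calc (M i j).length ≤ lam := hlam M (by simp) i j
        _ ≤ (2 * D + 2) ^ 0 * (lam + D + 1) := by rw [pow_zero, one_mul]; omega
    | M :: M' :: L', hL, _ => simp at hL
  | succ s ih =>
    intro L hL hlam
    -- split the list into two halves of length `≤ 2^s`
    set L₁ := L.take (2 ^ s) with hL₁
    set L₂ := L.drop (2 ^ s) with hL₂
    have h₁ : L₁.length ≤ 2 ^ s := by rw [hL₁, List.length_take]; exact min_le_left _ _
    have h₂ : L₂.length ≤ 2 ^ s := by rw [hL₂, List.length_drop, pow_succ] at *; omega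
    obtain ⟨P₁, hP₁, hv₁⟩ := ih L₁ h₁ fun M hM => hlam M (List.mem_of_mem_take hM)
    obtain ⟨P₂, hP₂, hv₂⟩ := ih L₂ h₂ fun M hM => hlam M (List.mem_of_mem_drop hM)
    refine ⟨Matrix.of fun i j => (List.ofFn fun t : Fin D => PatternExpr.mul (P₁ i t) (P₂ t j)).foldr
      PatternExpr.add (PatternExpr.const 0), fun i j => ?_, fun n ρ γ => ?_⟩
    · -- length: `Σ_t (|P₁ i t| + |P₂ t j| + 1) + D + 1 ≤ 2 D B + 2 D + 1 ≤ (2D+2) B`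
      simp only [Matrix.of_apply]
      rw [ShortClose.length_foldr_add, List.length_ofFn, List.map_ofFn, List.sum_ofFn]
      set B := (2 * D + 2) ^ s * (lam + D + 1) with hB
      have hBD : D + 1 ≤ B := by
        rw [hB]
        calc D + 1 ≤ lam + D + 1 := by omega
          _ = 1 * (lam + D + 1) := (one_mul _).symm
          _ ≤ (2 * D + 2) ^ s * (lam + D + 1) := Nat.mul_le_mul_right _ (Nat.one_le_pow _ _ (by omega))
      have hsum : ∑ t : Fin D, (Function.comp PatternExpr.length fun t : Fin D =>
          PatternExpr.mul (P₁ i t) (P₂ t j)) t ≤ ∑ _t : Fin D, (2 * B + 1) := by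
        refine Finset.sum_le_sum fun t _ => ?_
        simp only [Function.comp_apply, PatternExpr.length]
        have e1 := hP₁ i t
        have e2 := hP₂ t j
        omega
      rw [Finset.sum_const, Finset.card_univ, Fintype.card_fin, smul_eq_mul] at hsum
      calc _ ≤ D * (2 * B + 1) + D + 1 := by omega
        _ ≤ (2 * D + 2) * B := by nlinarith
        _ = (2 * D + 2) ^ (s + 1) * (lam + D + 1) := by rw [hB, pow_succ]; ring
    · -- value: `(P₁ P₂)_{ij} = Σ_t (P₁)_{it} (P₂)_{tj}` and `∏ L = ∏ L₁ · ∏ L₂`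
      have hL12 : L = L₁ ++ L₂ := (List.take_append_drop (2 ^ s) L).symm
      conv_rhs => rw [hL12, List.map_append, List.prod_append, ← hv₁ n ρ γ, ← hv₂ n ρ γ]
      ext i j
      simp only [Matrix.map_apply, Matrix.of_apply, Matrix.mul_apply]
      rw [value_foldr_add, List.map_ofFn, List.sum_ofFn]
      rfl

end NarrowClosure

end Summit.ValiantsHypothesis.ValiantsHypothesis.Theorems

end
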